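import Literature.Barriers.AtomisticToContinuum.KineticGapLengthScalesAssembly
import Literature.MathematicalPhysics.QuantumManyBody.GeneralizedPoincareProofs
import Literature.MathematicalPhysics.QuantumManyBody.BoseGasDirichletWall
import HarnessLib

/-!
# The free gas condenses in every gap-scale energy window (converse-in-order of the boost obstruction)

`Literature/Barriers/AtomisticToContinuum` — companion of `KineticGapLengthScalesNarrow.lean`
(Galilei boosts: energy windows `> 4π²M²N/L²` certify at most `N/(M+1)` in the constant mode) and
`KineticGapLengthScalesThermodynamicWindow.lean` (hence every super-gap windowed periodic-BEC
hypothesis is false), filed by the crux disprover of `PeriodicToDirichlet`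
(stmt-AtomisticToContinuum-9483; antecedent `PeriodicBEC` = stmt-0826's body).

* `natCast_le_condensateOccupation_add` — LSSY (5.15)/(5.17) at `R = 0` from the PROVED Lemma 4.1
  (`LSSY2005_lemma41_periodic_holds`) and the tree's `depletion_le_of_lemma41`,
  `condensateOccupation_add_depletion`: a universal `C` with
  `N ≤ ⟨Ψ, n₀Ψ⟩ + C L² ⟨Ψ, HΨ⟩` for every periodic `N`-body state (`N ≥ 2`) and every `v ≥ 0`.
* `free_gas_gapWindow_condensation` — for `v = 0`: every periodic state with
  `⟨Ψ, -ΔΨ⟩ ≤ κN/L²` (`κ = 1/(2C)`) has `≥ N/2` particles in the constant mode. With the boosts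
  this pins the admissible window of an energy-only condensation criterion to EXACTLY the order of
  one kinetic gap per particle.
* `periodicBEC_antecedent_free` — the `v = 0` INSTANCE of the periodic-BEC hypothesis
  (`∃ρ₀ ∀ρ ∃c ∀ᶠN ∃δ>0 ∀Ψ, ⟨Ψ,HΨ⟩ ≤ E₀^per + δ ⇒ ⟨Ψ,n₀Ψ⟩ ≥ cN`) holds (`c = 1/2`,
  `δ_N = κN/L_N²`): the free gas is not a counterexample to the antecedent of
  `PeriodicToDirichlet` / stmt-0827, so these cannot be closed ex falso there;
  `periodicBEC_free_gapWindow` — the same with the explicit gap-order window.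

Theorems only; `[folklore]` / LSSY Ch. 5.

## References

* [LSSY2005] E. H. Lieb, R. Seiringer, J. P. Solovej, J. Yngvason, *The Mathematics of the Bose Gas
  and its Condensation* (2005), Lemma 4.1 (4.2); Ch. 5 (5.15)–(5.17).
-/

noncomputable section

namespace Literature.Barriers.AtomisticToContinuum.BoseGas

open Literature.MathematicalPhysics.QuantumManyBody.BoseGas
open _root_.MeasureTheory _root_.Filter _root_.Topology
open scoped ENNReal NNReal

variable {N : ℕ} {L : ℝ}

/-- **Depletion costs kinetic energy at the gap rate, and no more is claimed**: there is a universal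
`C` with `N ≤ ⟨Ψ, n₀Ψ⟩ + C L² ⟨Ψ, HΨ⟩` for every periodic `N`-body state on the torus of side `L`
(`N ≥ 2`) and every `v ≥ 0` — LSSY's (5.15)/(5.17) with `R = 0` (Lemma 4.1 = Poincaré on every
slice, `LSSY2005_lemma41_periodic_holds`; the interaction only adds). [cite: LSSY2005, Ch. 5 (5.15)–(5.17)] -/
theorem natCast_le_condensateOccupation_add :
    ∃ C : ℝ, 0 < C ∧ ∀ (N : ℕ) (L : ℝ), 1 < N → 0 < L → ∀ (v : ℝ → ℝ≥0∞)
      (Ψ : PeriodicTrialState N L),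
      (N : ℝ≥0∞) ≤ condensateOccupation N L Ψ.ψ + ENNReal.ofReal (C * L ^ 2) * periodicEnergy v Ψ := by
  obtain ⟨C, hC, h41⟩ := LSSY2005_lemma41_periodic_holds
  refine ⟨C, hC, fun N L hN hL v Ψ => ?_⟩
  obtain ⟨n, rfl⟩ : ∃ n, N = n + 1 := ⟨N - 1, (Nat.sub_add_cancel hN.le).symm⟩
  have hdep := depletion_le_of_lemma41 h41 hN hL 0 Ψ
  have henc : encounterVolume (n + 1) 0 ^ (2 / 3 : ℝ) = 0 := by
    simp [encounterVolume, ENNReal.zero_rpow_of_pos (by norm_num : (0 : ℝ) < 2 / 3)]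
  rw [henc, zero_mul, add_zero] at hdep
  have hT : ∫⁻ X in cellN (n + 1) L, kineticOutside 0 Ψ.ψ X ≤ periodicEnergy v Ψ :=
    (lintegral_mono fun X => kineticOutside_le_kineticDensity 0 Ψ.ψ X).trans
      (lintegral_mono fun X => le_self_add)
  calc ((n + 1 : ℕ) : ℝ≥0∞)
      = condensateOccupation (n + 1) L Ψ.ψ + depletion (n + 1) L Ψ.ψ :=
        (condensateOccupation_add_depletion hL Ψ).symm
    _ ≤ condensateOccupation (n + 1) L Ψ.ψ +
          ENNReal.ofReal C * (ENNReal.ofReal (L ^ 2) * ∫⁻ X in cellN (n + 1) L, kineticOutside 0 Ψ.ψ X) := by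
        gcongr
    _ ≤ condensateOccupation (n + 1) L Ψ.ψ + ENNReal.ofReal (C * L ^ 2) * periodicEnergy v Ψ := by
        rw [ENNReal.ofReal_mul hC.le, mul_assoc]
        gcongr

/-- **The free gas condenses in every gap-scale energy window** (periodic box, any side `L > 0`,
`N ≥ 2`): with the universal `C` of `natCast_le_condensateOccupation_add`, every periodic state
with `⟨Ψ, -ΔΨ⟩ ≤ N/(2CL²)` has at least `N/2` particles in the constant mode. This is the
converse-in-order of the Galilei-boost obstruction (`energyWindow_fraction_le`: windows
`> 4π²M²N/L²` certify at most `N/(M+1)`): the admissible window for an energy-only condensation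
criterion is EXACTLY of the order of one kinetic gap per particle. [folklore] -/
theorem free_gas_gapWindow_condensation :
    ∃ κ : ℝ, 0 < κ ∧ ∀ (N : ℕ) (L : ℝ), 1 < N → 0 < L → ∀ Ψ : PeriodicTrialState N L,
      periodicEnergy 0 Ψ ≤ ENNReal.ofReal (κ * N / L ^ 2) →
        ENNReal.ofReal (N / 2) ≤ condensateOccupation N L Ψ.ψ := by
  obtain ⟨C, hC, h⟩ := natCast_le_condensateOccupation_add
  refine ⟨1 / (2 * C), by positivity, fun N L hN hL Ψ hΨ => ?_⟩
  have key := h N L hN hL 0 Ψ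
  have hwin : ENNReal.ofReal (C * L ^ 2) * periodicEnergy 0 Ψ ≤ ENNReal.ofReal (N / 2) := by
    calc ENNReal.ofReal (C * L ^ 2) * periodicEnergy 0 Ψ
        ≤ ENNReal.ofReal (C * L ^ 2) * ENNReal.ofReal (1 / (2 * C) * N / L ^ 2) := by gcongr
      _ = ENNReal.ofReal (N / 2) := by
          rw [← ENNReal.ofReal_mul (by positivity)]
          congr 1
          field_simp
  have hsplit : (N : ℝ≥0∞) = ENNReal.ofReal (N / 2) + ENNReal.ofReal (N / 2) := by
    rw [← ENNReal.ofReal_add (by positivity) (by positivity), add_halves, ENNReal.ofReal_natCast]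
  have h2 : condensateOccupation N L Ψ.ψ + ENNReal.ofReal (C * L ^ 2) * periodicEnergy 0 Ψ ≤
      condensateOccupation N L Ψ.ψ + ENNReal.ofReal (N / 2) := add_le_add le_rfl hwin
  have := key.trans h2
  rw [hsplit] at this
  exact (ENNReal.add_le_add_iff_right ENNReal.ofReal_ne_top).1 this

/-- **The antecedent `PeriodicBEC` holds for the free gas** (the `v = 0` instance of stmt-0826's
body, hence of the antecedent of `PeriodicToDirichlet` / stmt-0827): at every density, with
`c = 1/2`, for all `N ≥ 2`, the slack `δ_N = N/(2C L_N²) > 0` works. So `v = 0` is not a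
counterexample to the antecedent, and the crux cannot be closed ex falso at the free gas.
[folklore] -/
theorem periodicBEC_antecedent_free :
    ∃ ρ₀ : ℝ, 0 < ρ₀ ∧ ∀ ρ : ℝ, 0 < ρ → ρ < ρ₀ → ∃ c : ℝ, 0 < c ∧ ∀ᶠ N : ℕ in atTop,
      ∃ δ : ℝ≥0∞, 0 < δ ∧ ∀ Ψ : PeriodicTrialState N (sideLength ρ N),
        periodicEnergy 0 Ψ ≤ periodicGroundStateEnergy 0 N (sideLength ρ N) + δ →
          ENNReal.ofReal (c * N) ≤ condensateOccupation N (sideLength ρ N) Ψ.ψ := by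
  obtain ⟨κ, hκ, h⟩ := free_gas_gapWindow_condensation
  refine ⟨1, one_pos, fun ρ hρ _ => ⟨1 / 2, by norm_num, ?_⟩⟩
  filter_upwards [eventually_gt_atTop 1] with N hN
  have hN0 : 0 < N := lt_trans zero_lt_one hN
  have hL : 0 < sideLength ρ N := sideLength_pos_of_pos hρ hN0
  refine ⟨ENNReal.ofReal (κ * N / sideLength ρ N ^ 2), ?_, fun Ψ hΨ => ?_⟩
  · rw [ENNReal.ofReal_pos]
    have : (0 : ℝ) < N := Nat.cast_pos.2 hN0
    positivity
  · rw [periodicGroundStateEnergy_zero_eq_zero N hL, zero_add] at hΨ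
    have := h N (sideLength ρ N) hN hL Ψ hΨ
    convert this using 2
    ring

/-- The free-gas antecedent holds with ANY window of gap order `κ' N/L_N²`, `κ' ≤ κ`
(thermodynamic box; complements `not_periodicBEC_window`). [folklore] -/
theorem periodicBEC_free_gapWindow :
    ∃ κ : ℝ, 0 < κ ∧ ∀ ρ : ℝ, 0 < ρ → ∀ᶠ N : ℕ in atTop,
      ∀ Ψ : PeriodicTrialState N (sideLength ρ N),
        periodicEnergy 0 Ψ ≤ periodicGroundStateEnergy 0 N (sideLength ρ N) +
            ENNReal.ofReal (κ * N / sideLength ρ N ^ 2) →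
          ENNReal.ofReal (N / 2) ≤ condensateOccupation N (sideLength ρ N) Ψ.ψ := by
  obtain ⟨κ, hκ, h⟩ := free_gas_gapWindow_condensation
  refine ⟨κ, hκ, fun ρ hρ => ?_⟩
  filter_upwards [eventually_gt_atTop 1] with N hN Ψ hΨ
  have hL : 0 < sideLength ρ N := sideLength_pos_of_pos hρ (lt_trans zero_lt_one hN)
  rw [periodicGroundStateEnergy_zero_eq_zero N hL, zero_add] at hΨ
  exact h N (sideLength ρ N) hN hL Ψ hΨ

end Literature.Barriers.AtomisticToContinuum.BoseGas

end
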